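import Mathlib
import Summits.ResolutionOfSingularities.ResolutionOfSingularities.Theorems.WeightedInvariantDatumToEmbeddedQuotientSingularitiesSliceZero
import HarnessLib

/-!
# Slice theorem, step 2: the base point of the slice and smoothness around it

Topic: `Summits/ResolutionOfSingularities/ResolutionOfSingularities/Theorems`. Helper file of the
stub `stub_qs_sliceCore` of the line `Sketch` of the crux
`Theses.WeightedInvariant.DatumToEmbedded` (statement `stmt-ResolutionOfSingularities-0572`).

Setting of `…QuotientSingularitiesSlice`: a `k`-algebra `R = ⨁_{χ ∈ G} R_χ` graded by an abelian
group `G`, a `k`-algebra map `π : R → κ` to a field (the residue field of a closed point), a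
lattice `M ≤ G` with `ℤ`-basis `b` and homogeneous units `uₗ ∈ R_{bₗ}`, the slice
`S = (κ ⊗ₖ R) ⧸ (1 ⊗ uₗ - π uₗ ⊗ 1)ₗ` graded by `A = G ⧸ M` (`slicePiece`), `S₀ ≅ R₀ ⊗ₖ κ`.

* `sliceEval : S →ₐ[k] κ`, `(c ⊗ r)‾ ↦ c · π r` — the base point `y` of the slice (the closed
  point we started from), and `slicePrimeZero = ker (S₀ → S → κ)`, its image `t` in `Spec S₀`.
* `toSlice_mem_of_over` — if `π` kills every `R_χ` with `χ ∉ M` and `R` has homogeneous units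
  in all degrees `e • χ` (`e ≥ 1`), then EVERY prime `𝔶` of `S` lying over `t` contains the
  `(1 ⊗ r)‾`, `r ∈ R_χ`, `χ ∉ M`: `r ^ e = (r ^ e w⁻¹) w` with `w` the unit of degree `e • χ` and
  `(1 ⊗ r ^ e w⁻¹)‾ ∈ t S`. Hence `S` is smooth over `k` at every such `𝔶`
  (`isSmoothAt_of_over`, from the Jacobian criterion `isSmoothAt_slice` of
  `…QuotientSingularitiesSmoothAt`) as soon as `κ ⊗ₖ R` is smooth over `k`.
* `algebra_isIntegral_gradeZero` — an algebra graded by a FINITE abelian group is integral over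
  its degree-`0` part (`s ∈ S_a ⇒ s ^ {ord a} ∈ S₀`); so `Spec S → Spec S₀` is closed and
  surjective onto its image, and
* `exists_notMem_smooth_away` — **there is `s₀ ∈ S₀ ∖ t` with `S[1/s₀]` smooth over `k`**: the
  non-smooth locus `V(J)` of the finitely presented `k`-algebra `S` (Mathlib
  `Algebra.isOpen_smoothLocus`) misses the fibre over `t`, so by lying-over for the integral
  extension `S₀ → S` the ideal `J ∩ S₀` is not contained in `t`; any `s₀ ∈ (J ∩ S₀) ∖ t` works
  (`Algebra.basicOpen_subset_smoothLocus_iff_smooth`).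

Only Mathlib and the sibling helper files are used. [folklore: Luna's étale slice theorem for
diagonalizable groups, Zariski form; cf. Abramovich–Temkin, *Torification of diagonalizable
group actions on toroidal schemes*, arXiv:1407.2629, §5.1, and Alper–Hall–Rydh]
-/

-- the summit namespace repeats `ResolutionOfSingularities` by design (mandated namespace)
set_option linter.dupNamespace false

namespace Summit.ResolutionOfSingularities.ResolutionOfSingularities.Theorems.DatumToEmbedded.QuotientSingularities

open DirectSum TensorProduct Literature.RingTheory.GradedAlgebra

/-! ## An algebra graded by a finite group is integral over its degree-zero part -/

section Integral

/-- **An algebra graded by a finite abelian group is integral over its degree-`0` part**: a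
homogeneous element `s` of degree `a` has `s ^ (ord a) ∈ A₀`. [folklore] -/
theorem algebra_isIntegral_gradeZero {ι R A : Type*} [DecidableEq ι] [AddCommGroup ι] [Finite ι]
    [CommRing R] [CommRing A] [Algebra R A] (𝒜 : ι → Submodule R A) [GradedAlgebra 𝒜] :
    Algebra.IsIntegral (𝒜 0) A := by
  refine ⟨fun x => ?_⟩
  induction x using DirectSum.Decomposition.inductionOn 𝒜 with
  | zero => exact isIntegral_zero
  | add x y hx hy => exact hx.add hy
  | homogeneous x =>
    obtain ⟨x, hx⟩ := x
    rename_i i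
    have hn : 0 < addOrderOf i := (isOfFinAddOrder_of_finite i).addOrderOf_pos
    refine IsIntegral.of_pow hn ?_
    have hmem : x ^ addOrderOf i ∈ 𝒜 0 := by
      simpa [addOrderOf_nsmul_eq_zero] using SetLike.pow_mem_graded (addOrderOf i) hx
    exact (isIntegral_algebraMap (R := 𝒜 0) (A := A) (x := ⟨_, hmem⟩))

end Integral

section Setting

variable {k : Type} [Field k] {R : Type} [CommRing R] [Algebra k R]
  {G : Type} [AddCommGroup G] [DecidableEq G] (𝓡 : G → Submodule k R) [GradedAlgebra 𝓡]
  {κ : Type} [Field κ] [Algebra k κ] (π : R →ₐ[k] κ) (M : Submodule ℤ G)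
  {m : ℕ} (b : Module.Basis (Fin m) ℤ M) (u : Fin m → R)
  (hu : ∀ l, u l ∈ 𝓡 (b l)) (hunit : ∀ l, IsUnit (u l))

/-! ## The base point of the slice -/

/-- The evaluation `κ ⊗ₖ R → κ`, `c ⊗ r ↦ c · π r` (the `κ`-point of `Spec (κ ⊗ₖ R)` over the
point `π`). [folklore] -/
noncomputable def baseEval : κ ⊗[k] R →ₐ[k] κ :=
  Algebra.TensorProduct.lift (AlgHom.id k κ) π fun _ _ => Commute.all _ _

omit [DecidableEq G] in
/-- Unfolding `baseEval` on pure tensors. [folklore] -/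
theorem baseEval_tmul (c : κ) (r : R) : baseEval π (c ⊗ₜ r) = c * π r :=
  Algebra.TensorProduct.lift_tmul _ _ _ c r

omit [DecidableEq G] in
/-- The base point lies on the slice: `baseEval` kills the generators `1 ⊗ uₗ - π uₗ ⊗ 1`.
[folklore] -/
theorem baseEval_sliceGen (l : Fin m) : baseEval π (sliceGen k u (resUnit π u) l) = 0 := by
  change baseEval π ((1 : κ) ⊗ₜ u l - resUnit π u l ⊗ₜ (1 : R)) = 0
  rw [map_sub, baseEval_tmul, baseEval_tmul, map_one, one_mul, mul_one, sub_self]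

omit [DecidableEq G] in
/-- The ideal of the slice is killed by `baseEval`. [folklore] -/
theorem sliceIdeal_le_ker_baseEval : sliceIdeal k π u ≤ RingHom.ker (baseEval π) :=
  Ideal.span_le.2 (Set.range_subset_iff.2 fun l => baseEval_sliceGen π u l)

/-- **The base point of the slice**: the evaluation `S → κ`, `(c ⊗ r)‾ ↦ c · π r`. [folklore] -/
noncomputable def sliceEval : Slice k π u →ₐ[k] κ :=
  Ideal.Quotient.liftₐ (sliceIdeal k π u) (baseEval π) fun _ ha => sliceIdeal_le_ker_baseEval π u ha

omit [DecidableEq G] in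
/-- Unfolding `sliceEval` on classes. [folklore] -/
theorem sliceEval_mk (x : κ ⊗[k] R) :
    sliceEval π u (Ideal.Quotient.mk (sliceIdeal k π u) x) = baseEval π x :=
  rfl

omit [DecidableEq G] in
/-- `sliceEval (1 ⊗ r)‾ = π r`. [folklore] -/
theorem sliceEval_toSlice (r : R) : sliceEval π u (toSlice k π u r) = π r := by
  rw [toSlice_apply, sliceEval_mk, baseEval_tmul, one_mul]

variable [DecidableEq (G ⧸ M)]

/-- The evaluation restricted to the degree-`0` part, `S₀ → κ`. [folklore] -/
noncomputable def sliceZeroEval : slicePiece k 𝓡 π M b u hu 0 →+* κ :=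
  (sliceEval π u).toRingHom.comp (algebraMap (slicePiece k 𝓡 π M b u hu 0) (Slice k π u))

/-- Unfolding `sliceZeroEval`. [folklore] -/
theorem sliceZeroEval_apply (z : slicePiece k 𝓡 π M b u hu 0) :
    sliceZeroEval 𝓡 π M b u hu z = sliceEval π u (z : Slice k π u) :=
  rfl

/-- **The image `t` of the base point in `Spec S₀`**: the kernel of `S₀ → S → κ`. [folklore] -/
noncomputable def slicePrimeZero : Ideal (slicePiece k 𝓡 π M b u hu 0) :=
  RingHom.ker (sliceZeroEval 𝓡 π M b u hu)

/-- Membership in `t`. [folklore] -/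
theorem mem_slicePrimeZero_iff (z : slicePiece k 𝓡 π M b u hu 0) :
    z ∈ slicePrimeZero 𝓡 π M b u hu ↔ sliceEval π u (z : Slice k π u) = 0 :=
  RingHom.mem_ker

/-- `t` is prime (`κ` is a field). [folklore] -/
instance slicePrimeZero.isPrime : (slicePrimeZero 𝓡 π M b u hu).IsPrime :=
  RingHom.ker_isPrime _

/-! ## Every prime over the base point is good -/

/-- **Every prime of the slice over `t` contains the `(1 ⊗ r)‾`, `r ∈ R_χ`, `χ ∉ M`**, provided
`π` kills these `R_χ` and `R` has homogeneous units in all degrees `e • χ`, `e ≥ 1`: with `w` the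
unit of degree `e • χ`, `(1 ⊗ r ^ e w⁻¹)‾ ∈ S₀` is killed by the evaluation, so lies in `t S ⊆ 𝔶`,
and `(1 ⊗ r)‾ ^ e = (1 ⊗ r ^ e w⁻¹)‾ (1 ⊗ w)‾ ∈ 𝔶`. [folklore] -/
theorem toSlice_mem_of_over {e : ℕ} (he : 0 < e) (hunitR : ∀ χ : G, ∃ w ∈ 𝓡 (e • χ), IsUnit w)
    (hπ : ∀ χ ∉ M, ∀ r ∈ 𝓡 χ, π r = 0) (𝔶 : Ideal (Slice k π u)) [𝔶.IsPrime]
    (h𝔶 : ∀ z ∈ slicePrimeZero 𝓡 π M b u hu, (z : Slice k π u) ∈ 𝔶) {χ : G} (hχ : χ ∉ M)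
    {r : R} (hr : r ∈ 𝓡 χ) : toSlice k π u r ∈ 𝔶 := by
  obtain ⟨w, hw, hwu⟩ := hunitR χ
  obtain ⟨w', hw', hww', -⟩ := exists_inv_mem_of_isUnit 𝓡 hw hwu
  have h0 : r ^ e * w' ∈ 𝓡 0 := by
    simpa using SetLike.mul_mem_graded (SetLike.pow_mem_graded e hr) hw'
  -- `(1 ⊗ r ^ e w')‾ ∈ S₀` is killed by the evaluation
  have hz : (⟨toSlice k π u (r ^ e * w'), toSlice_mem_zero 𝓡 π M b u hu M.zero_mem h0⟩ :
      slicePiece k 𝓡 π M b u hu 0) ∈ slicePrimeZero 𝓡 π M b u hu := by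
    rw [mem_slicePrimeZero_iff]
    change sliceEval π u (toSlice k π u (r ^ e * w')) = 0
    rw [sliceEval_toSlice, map_mul, map_pow, hπ χ hχ r hr, zero_pow he.ne', zero_mul]
  have hmem : toSlice k π u (r ^ e * w') ∈ 𝔶 := h𝔶 _ hz
  refine Ideal.IsPrime.mem_of_pow_mem ‹𝔶.IsPrime› e ?_
  have hre : r ^ e = r ^ e * w' * w := by rw [mul_assoc, mul_comm w' w, hww', mul_one]
  rw [← map_pow, hre, map_mul]
  exact 𝔶.mul_mem_right _ hmem

include hunit in
/-- **The slice is smooth over `k` at every prime over the base point** (if `κ ⊗ₖ R` is smooth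
over `k`, `π` kills the `R_χ` with `χ ∉ M`, and there are homogeneous units in all degrees
`e • χ`). [folklore] -/
theorem isSmoothAt_of_over [Algebra.Smooth k (κ ⊗[k] R)] {e : ℕ} (he : 0 < e)
    (hunitR : ∀ χ : G, ∃ w ∈ 𝓡 (e • χ), IsUnit w) (hπ : ∀ χ ∉ M, ∀ r ∈ 𝓡 χ, π r = 0)
    (𝔶 : Ideal (Slice k π u)) [𝔶.IsPrime]
    (h𝔶 : ∀ z ∈ slicePrimeZero 𝓡 π M b u hu, (z : Slice k π u) ∈ 𝔶) :
    Algebra.IsSmoothAt k 𝔶 :=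
  isSmoothAt_slice 𝓡 M b u (resUnit π u) hu hunit 𝔶 fun _ hχ _ hr =>
    toSlice_mem_of_over 𝓡 π M b u hu he hunitR hπ 𝔶 h𝔶 hχ hr

/-! ## Shrinking to a smooth degree-zero basic open -/

omit [DecidableEq G] [GradedAlgebra 𝓡] in
/-- The slice is a finitely presented `k`-algebra (if `κ ⊗ₖ R` is). [folklore] -/
theorem finitePresentation_slice [Algebra.FinitePresentation k (κ ⊗[k] R)] :
    Algebra.FinitePresentation k (Slice k π u) :=
  Algebra.FinitePresentation.quotient
    ⟨(Set.finite_range (sliceGen k u (resUnit π u))).toFinset, by rw [Set.Finite.coe_toFinset]⟩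

include hunit in
/-- **Shrinking the slice to a smooth invariant neighbourhood of the base point**: there is
`s₀ ∈ S₀ ∖ t` such that `S[1/s₀]` is smooth over `k`. The non-smooth locus `V(J)` of `S` is
closed and misses every prime over `t`; `S` being integral over `S₀`, lying-over shows
`J ∩ S₀ ⊄ t`, and `D(s₀)` lies in the smooth locus for any `s₀ ∈ (J ∩ S₀) ∖ t`. [folklore] -/
theorem exists_notMem_smooth_away [Finite (G ⧸ M)] [Algebra.Smooth k (κ ⊗[k] R)] {e : ℕ}
    (he : 0 < e) (hunitR : ∀ χ : G, ∃ w ∈ 𝓡 (e • χ), IsUnit w)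
    (hπ : ∀ χ ∉ M, ∀ r ∈ 𝓡 χ, π r = 0) :
    ∃ s₀ : slicePiece k 𝓡 π M b u hu 0, s₀ ∉ slicePrimeZero 𝓡 π M b u hu ∧
      Algebra.Smooth k (Localization.Away (s₀ : Slice k π u)) := by
  haveI := finitePresentation_slice π u
  -- the non-smooth locus `V(J)`
  obtain ⟨J, hJ⟩ := (PrimeSpectrum.isClosed_iff_zeroLocus_ideal _).1
    (Algebra.isOpen_smoothLocus (R := k) (A := Slice k π u)).isClosed_compl
  -- `J ∩ S₀ ⊄ t`
  have key : ∃ s₀ : slicePiece k 𝓡 π M b u hu 0,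
      (s₀ : Slice k π u) ∈ J ∧ s₀ ∉ slicePrimeZero 𝓡 π M b u hu := by
    by_contra hcon
    have hle : J.comap (algebraMap (slicePiece k 𝓡 π M b u hu 0) (Slice k π u)) ≤
        slicePrimeZero 𝓡 π M b u hu := fun z hz => by
      by_contra hzt
      exact hcon ⟨z, hz, hzt⟩
    haveI := algebra_isIntegral_gradeZero (slicePiece k 𝓡 π M b u hu)
    obtain ⟨Q, hQJ, hQ, hQt⟩ :=
      Ideal.exists_ideal_over_prime_of_isIntegral (slicePrimeZero 𝓡 π M b u hu) J hle
    have hsm : Algebra.IsSmoothAt k Q :=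
      isSmoothAt_of_over 𝓡 π M b u hu hunit he hunitR hπ Q fun z hz => by
        rw [← hQt] at hz
        exact hz
    have hQmem : (⟨Q, hQ⟩ : PrimeSpectrum (Slice k π u)) ∈ (Algebra.smoothLocus k (Slice k π u))ᶜ := by
      rw [hJ]
      exact hQJ
    exact hQmem hsm
  obtain ⟨s₀, hs₀J, hs₀t⟩ := key
  refine ⟨s₀, hs₀t, Algebra.basicOpen_subset_smoothLocus_iff_smooth.1 fun p hp => ?_⟩
  by_contra hp'
  have hpJ : p ∈ PrimeSpectrum.zeroLocus (J : Set (Slice k π u)) := by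
    rw [← hJ]
    exact hp'
  exact hp (hpJ hs₀J)

end Setting

/-! ## Registered form -/

/-- **Registered sub-goal `stub_qs_sliceSmooth`** of the crux (helper of the stub
`stub_qs_sliceCore`): the slice has a degree-`0` basic open through its base point which is
smooth over `k`. [folklore] -/
theorem stub_qs_sliceSmooth :
    ∀ {k : Type} [Field k] {R : Type} [CommRing R] [Algebra k R] {G : Type} [AddCommGroup G]
      [DecidableEq G] (𝓡 : G → Submodule k R) [GradedAlgebra 𝓡] {κ : Type} [Field κ] [Algebra k κ]
      (π : R →ₐ[k] κ) (M : Submodule ℤ G) {m : ℕ} (b : Module.Basis (Fin m) ℤ M) (u : Fin m → R) (hu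
      : ∀ l, u l ∈ 𝓡 (b l)), (∀ l, IsUnit (u l)) → ∀ [DecidableEq (G ⧸ M)] [Finite (G ⧸ M)]
      [Algebra.Smooth k (TensorProduct k κ R)] {e : ℕ}, 0 < e → (∀ χ : G, ∃ w ∈ 𝓡 (e • χ), IsUnit w)
      → (∀ χ ∉ M, ∀ r ∈ 𝓡 χ, π r = 0) → ∃ s₀ :
      ↥(Summit.ResolutionOfSingularities.ResolutionOfSingularities.Theorems.DatumToEmbedded.QuotientSingularities.slicePiece
      k 𝓡 π M b u hu 0), s₀ ∉
      Summit.ResolutionOfSingularities.ResolutionOfSingularities.Theorems.DatumToEmbedded.QuotientSingularities.slicePrimeZero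
      𝓡 π M b u hu ∧ Algebra.Smooth k (Localization.Away (s₀ :
      Summit.ResolutionOfSingularities.ResolutionOfSingularities.Theorems.DatumToEmbedded.QuotientSingularities.Slice
      k π u)) := by
  intro k _ R _ _ G _ _ 𝓡 _ κ _ _ π M m b u hu hunit _ _ _ e he hunitR hπ
  exact exists_notMem_smooth_away 𝓡 π M b u hu hunit he hunitR hπ

end Summit.ResolutionOfSingularities.ResolutionOfSingularities.Theorems.DatumToEmbedded.QuotientSingularities
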